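import Summits.CriticalPhenomena.PercolationContinuityZ3.Theorems.PercNearOneGluingNoHeavyPcintPriceLawInputs
import Summits.CriticalPhenomena.PercolationContinuityZ3.Theorems.PercNearOneGluingNoHeavyPcintClassCountLaw
import Summits.CriticalPhenomena.PercolationContinuityZ3.Theorems.PercNearOneGluingNoHeavyPcintMemoryTailLimit
import Literature.Probability.RandomPlanarGeometry.SAWTriangularLoopRatioLimit
import HarnessLib

/-!
# CriticalPhenomena/PercolationContinuityZ3 — Theorems/PercNearOneGluingNoHeavyPcintPriceLaw.lean:
# the STRUCTURE conjecture C3 (i) `MemoryTail.priceLaw` is a THEOREM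

Lane prim-pcint (paper-2 track (iii)), coordinator STANDING RULE «NUMERICS ⇒ STRUCTURE ⇒ CONJECTURE» (2026-08-22): the
class-count (cost) law C3 of the lane's memory automata was found numerically (prim-pcint-2 gen 13: the cost of one more
memory rung `N(τ+2)/N(τ) = 15.10, 16.32, 17.10, 17.66` on `ℤ³`, `5.24 … 6.12` on `ℤ²`, rising), pre-registered and scored
(P8/P8g/P9/P9x/P10: ≈ 135 histogram bins at zero tolerance), reduced to an IDENTITY (the states ARE the near self-avoiding
walks, `…PcintMemAutomatonCensusSum`) and TYPED as `@[conjecture] MemoryTail.priceLaw` (`…PcintClassCountLaw.lean`,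
p356482): `memStates d (2m+2) / memStates d (2m) → μ(ℤ^d)²` for every `d ≥ 2`.  THIS FILE PROVES IT
(`priceLaw_holds`), so C3 (i) leaves the conjecture ledger: the price of a memory rung tends to `μ²` EXACTLY.

PROOF (Kesten 1963 / Madras–Slade §7.3, for a new family).  (1) BRIDGE: `memStates (d+2) (2k) = |nearFam d k|`
(`memStates_two_mul_eq_card_nearFam`; the word model of the lane and the vertex-function model of the SAW library agree walk
by walk, `wordPath_injective` + `card_sawWords_eq_count`, endpoint preserved).  (2) KESTEN'S INEQUALITY for
`ψ_k = |nearFam d (k+1)|/|nearFam d k|` (`nearFam_kesten_ineq`, `…PcintPriceLawInputs.lean`): the near family is closed under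
the `(U,Q) ↔ (V,Q)` swap (endpoint fixed, length `±2`), the graded double counting (7.3.6)–(7.3.8)
(`…PcintPriceLawEngine.lean`), Kesten's pattern theorem and the envelopes.  (3) GROWTH: `memStates (d+2) (n+2)^{1/n} → μ`
from `e^{-c√k} μ^{2k} ≤ |nearFam d k| ≤ e^{15√k} μ^{2k}` (`tendsto_memStates_rpow`).  (4) Kesten's analytic Lemma 7.3.1
(`SAW.Zd.tendsto_ratio_of_kesten`) on `a_n = memStates (d+2) (n+2)` (constant on the pairs `{2k, 2k+1}` by the parity law
`memStates_odd`, so `a_{n+2}/a_n = ψ_{⌊n/2⌋+1}`): `a_{n+2}/a_n → μ²`, which along even `n` is the price law.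

NOT proved here: C3 (ii) `polygonFraction` (the top census piece is a fixed fraction of the states) — it needs tightness of
the slack profile, not only ratio limits.  Source: N. Madras, G. Slade, *The Self-Avoiding Walk* (1993), Lemma 7.3.1,
Theorem 7.3.2, Theorem 7.3.4; H. Kesten, J. Math. Phys. 4 (1963) 960–969 [MadrasSlade1993].
Written by prim-pcint-2 gen 14 (prover-prim-pcint-2-g14-0), 2026-08-23.
-/

noncomputable section

open Filter Topology Literature.Probability.LatticeModels Literature.Probability.Percolation
open Literature.Probability.RandomPlanarGeometry.SAW.Zd
open scoped BigOperators

namespace Summit.CriticalPhenomena.PercolationContinuityZ3.Theorems.Pcint.MemoryTail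

variable {d : ℕ}

/-! ### (1) The bridge: `memStates (d+2) (2k) = |nearFam d k|` -/

/-- The near words of the lane (step-word model) and the near walks of the SAW library (vertex-function model) are
equinumerous, length by length: `w ↦ (i ↦ wordPos w (min i m))` is a bijection `sawWords → saws` fixing the endpoint.
[cite: MadrasSlade1993, §1.1] -/
theorem card_nearWords_eq_card_nearFun (d τ m : ℕ) : (nearWords (d + 2) τ m).card = (nearFun d τ m).card := by
  classical
  have hinj : Function.Injective (fun (w : Fin m → Fin (d + 2) × Bool) (i : ℕ) => wordPos w (min i m)) :=
    wordPath_injective m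
  have himg : (sawWords (d + 2) m).image (fun (w : Fin m → Fin (d + 2) × Bool) (i : ℕ) => wordPos w (min i m)) =
      saws (d + 2) m := by
    apply Finset.eq_of_subset_of_card_le
    · intro ω hω
      obtain ⟨w, hw, rfl⟩ := Finset.mem_image.1 hω
      exact wordPath_mem_saws (mem_sawWords.1 hw)
    · rw [Finset.card_image_of_injective _ hinj, card_sawWords_eq_count, card_saws]
  unfold nearWords nearFun
  rw [← himg, Finset.filter_image, Finset.card_image_of_injective _ hinj]
  congr 1
  refine Finset.filter_congr fun w _ => ?_
  simp only [min_self]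
  rfl

/-- **`memStates (d+2) (2k) = |nearFam d k|`**: the state count of the memory-`2k` automaton (census identity,
`…PcintClassCountLaw`) is the size of the graded near family. [folklore] -/
theorem memStates_two_mul_eq_card_nearFam (d k : ℕ) : memStates (d + 2) (2 * k) = (nearFam d k).card := by
  rw [memStates, card_nearFam]
  exact Finset.sum_congr rfl fun m _ => card_nearWords_eq_card_nearFun d (2 * k) m

/-- `memStates (d+2) (n+2) = |nearFam d ((n+2)/2)|` for every `n` (parity law `memStates_odd` at odd `n+2`). [folklore] -/
theorem memStates_add_two_eq_card_nearFam (d n : ℕ) :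
    memStates (d + 2) (n + 2) = (nearFam d ((n + 2) / 2)).card := by
  rcases Nat.even_or_odd n with ⟨j, hj⟩ | ⟨j, hj⟩
  · rw [hj, show j + j + 2 = 2 * (j + 1) by ring, memStates_two_mul_eq_card_nearFam]
    congr 2
    omega
  · rw [hj, show 2 * j + 1 + 2 = 2 * (j + 1) + 1 by ring, memStates_odd (by omega), memStates_two_mul_eq_card_nearFam]
    congr 2
    omega

/-! ### (3) Growth: `memStates (d+2) (n+2)^{1/n} → μ` -/

/-- `√(x + 2) ≤ √x + 2` for `x ≥ 0`. [folklore] -/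
theorem sqrt_add_two_le {x : ℝ} (hx : 0 ≤ x) : Real.sqrt (x + 2) ≤ Real.sqrt x + 2 := by
  rw [Real.sqrt_le_left (by positivity)]
  nlinarith [Real.sq_sqrt hx, Real.sqrt_nonneg x]

/-- **Log envelope**: `|log memStates (d+2) (n+2) − n log μ| ≤ c√n + C` for all `n` (lower: the polygon envelope of
`nearFam d ⌊(n+2)/2⌋`; upper: Hammersley–Welsh on `nearFam d (⌊(n+2)/2⌋+1)`).
[cite: MadrasSlade1993, Corollary 3.2.5 and Theorem 3.1.1] -/
theorem exists_logEnvelope_memStates (d : ℕ) : ∃ c C : ℝ, 0 ≤ c ∧ ∀ n : ℕ,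
    |Real.log (memStates (d + 2) (n + 2) : ℝ) - n * Real.log (connectiveConstant (d + 2))| ≤ c * Real.sqrt n + C := by
  obtain ⟨c, hc0, hlow⟩ := exists_lower_envelope d
  set μ := connectiveConstant (d + 2) with hμ
  have hμ1 : 1 ≤ μ := one_le_connectiveConstant (d + 2)
  have hμ0 : 0 < μ := by linarith
  have hL : 0 ≤ Real.log μ := Real.log_nonneg hμ1
  refine ⟨15 + c, 30 + 2 * c + 4 * Real.log μ, by positivity, fun n => ?_⟩
  set k := (n + 2) / 2 with hk
  have hk1 : 1 ≤ k := by omega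
  have h2k : 2 * k ≤ n + 2 := by omega
  have h2k' : n + 1 ≤ 2 * k := by omega
  have hn0 : (0 : ℝ) ≤ n := Nat.cast_nonneg _
  have hsn : Real.sqrt ((n : ℝ) + 2) ≤ Real.sqrt n + 2 := sqrt_add_two_le hn0
  have hkle : (k : ℝ) ≤ n + 2 := by exact_mod_cast (show k ≤ n + 2 by omega)
  have hsk : Real.sqrt (k : ℝ) ≤ Real.sqrt n + 2 := (Real.sqrt_le_sqrt hkle).trans hsn
  have hk1le : ((k + 1 : ℕ) : ℝ) ≤ n + 2 := by exact_mod_cast (show k + 1 ≤ n + 2 by omega)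
  have hsk1 : Real.sqrt ((k + 1 : ℕ) : ℝ) ≤ Real.sqrt n + 2 := (Real.sqrt_le_sqrt hk1le).trans hsn
  have hpos : (0 : ℝ) < memStates (d + 2) (n + 2) := by exact_mod_cast one_le_memStates (by omega) (d + 2)
  -- lower bound
  have hlo : -(c * Real.sqrt k) + (2 * k : ℕ) * Real.log μ ≤ Real.log (memStates (d + 2) (n + 2) : ℝ) := by
    have h1 : Real.exp (-(c * Real.sqrt k)) * μ ^ (2 * k) ≤ memStates (d + 2) (n + 2) := by
      refine (hlow k hk1).trans ?_
      rw [← memStates_two_mul_eq_card_nearFam]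
      exact_mod_cast memStates_mono h2k (d + 2)
    have h2 := Real.log_le_log (by positivity) h1
    rwa [Real.log_mul (Real.exp_pos _).ne' (by positivity), Real.log_exp, Real.log_pow] at h2
  -- upper bound
  have hhi : Real.log (memStates (d + 2) (n + 2) : ℝ) ≤ 15 * Real.sqrt ((k + 1 : ℕ) : ℝ) + (2 * (k + 1) : ℕ) * Real.log μ := by
    have h1 : (memStates (d + 2) (n + 2) : ℝ) ≤ Real.exp (15 * Real.sqrt ((k + 1 : ℕ) : ℝ)) * μ ^ (2 * (k + 1)) := by
      refine le_trans ?_ (card_nearFam_le_exp d (k + 1))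
      rw [← memStates_two_mul_eq_card_nearFam]
      exact_mod_cast memStates_mono (by omega : n + 2 ≤ 2 * (k + 1)) (d + 2)
    have h2 := Real.log_le_log hpos h1
    rwa [Real.log_mul (Real.exp_pos _).ne' (by positivity), Real.log_exp, Real.log_pow] at h2
  rw [abs_le]
  constructor
  · -- `-(c√k) + 2k L ≥ -(15+c)√n - C + n L`
    have h3 : (n : ℝ) * Real.log μ ≤ ((2 * k : ℕ) : ℝ) * Real.log μ :=
      mul_le_mul_of_nonneg_right (by exact_mod_cast (by omega : n ≤ 2 * k)) hL
    have h4 : c * Real.sqrt k ≤ c * (Real.sqrt n + 2) := mul_le_mul_of_nonneg_left hsk hc0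
    nlinarith [Real.sqrt_nonneg (n : ℝ)]
  · have h3 : ((2 * (k + 1) : ℕ) : ℝ) * Real.log μ ≤ ((n : ℝ) + 4) * Real.log μ :=
      mul_le_mul_of_nonneg_right (by exact_mod_cast (by omega : 2 * (k + 1) ≤ n + 4)) hL
    nlinarith [Real.sqrt_nonneg (n : ℝ)]

/-- **`memStates (d+2) (n+2)^{1/n} → μ(ℤ^{d+2})`** (the growth rate of the state count is the connective constant).
[cite: MadrasSlade1993, Lemma 7.3.1 (i); Corollary 3.2.5] -/
theorem tendsto_memStates_rpow (d : ℕ) :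
    Tendsto (fun n : ℕ => ((memStates (d + 2) (n + 2) : ℕ) : ℝ) ^ (1 / (n : ℝ))) atTop
      (𝓝 (connectiveConstant (d + 2))) := by
  obtain ⟨c, C, hc, h⟩ := exists_logEnvelope_memStates d
  have hpos : ∀ n : ℕ, (0 : ℝ) < memStates (d + 2) (n + 2) := fun n => by
    exact_mod_cast one_le_memStates (by omega) (d + 2)
  have := Literature.Probability.RandomPlanarGeometry.SAW.tendsto_rpow_of_logEnvelope
    (a := fun n => (memStates (d + 2) (n + 2) : ℝ)) hpos hc h
  rwa [Real.exp_log (connectiveConstant_pos (d + 2))] at this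

/-! ### (4) The price law -/

/-- **Kesten's ratio limit for the state counts**: `memStates (d+2) (n+4) / memStates (d+2) (n+2) → μ(ℤ^{d+2})²`
(all `n`; along odd `n+2` the ratio is the even one by the parity law).
[cite: MadrasSlade1993, Lemma 7.3.1 and Theorem 7.3.2] -/
theorem tendsto_memStates_ratio (d : ℕ) :
    Tendsto (fun n : ℕ => (memStates (d + 2) (n + 4) : ℝ) / memStates (d + 2) (n + 2)) atTop
      (𝓝 (connectiveConstant (d + 2) ^ 2)) := by
  have hapos : ∀ n : ℕ, (0 : ℝ) < memStates (d + 2) (n + 2) := fun n => by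
    exact_mod_cast one_le_memStates (by omega) (d + 2)
  have haG : ∀ n : ℕ, (memStates (d + 2) (n + 2) : ℝ) = (nearFam d ((n + 2) / 2)).card := fun n => by
    exact_mod_cast memStates_add_two_eq_card_nearFam d n
  -- (ii) ratios ≥ 1
  have hii : ∃ c : ℝ, 0 < c ∧ ∀ᶠ n : ℕ in atTop,
      c ≤ (memStates (d + 2) (n + 2 + 2) : ℝ) / memStates (d + 2) (n + 2) := by
    refine ⟨1, one_pos, Eventually.of_forall fun n => ?_⟩
    rw [le_div_iff₀ (hapos n), one_mul]
    exact_mod_cast memStates_mono (by omega : n + 2 ≤ n + 2 + 2) (d + 2)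
  -- (iii) Kesten's inequality, transported from the level index `k = ⌊(n+2)/2⌋`
  have hiii : ∃ D : ℝ, ∀ᶠ n : ℕ in atTop,
      ((memStates (d + 2) (n + 2 + 2) : ℝ) / memStates (d + 2) (n + 2)) ^ 2 - D / n ≤
        ((memStates (d + 2) (n + 2 + 2) : ℝ) / memStates (d + 2) (n + 2)) *
          ((memStates (d + 2) (n + 4 + 2) : ℝ) / memStates (d + 2) (n + 2 + 2)) := by
    obtain ⟨D, hD⟩ := nearFam_kesten_ineq d
    obtain ⟨K, hK⟩ := eventually_atTop.1 hD
    refine ⟨2 * |D|, eventually_atTop.2 ⟨2 * K + 1, fun n hn => ?_⟩⟩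
    obtain ⟨k, hk⟩ : ∃ k, k = (n + 2) / 2 := ⟨_, rfl⟩
    have hkK : K ≤ k := by omega
    have hk0 : (0 : ℝ) < k := by exact_mod_cast (show 0 < k by omega)
    have hn0 : (0 : ℝ) < n := by exact_mod_cast (show 0 < n by omega)
    have e0 : (memStates (d + 2) (n + 2) : ℝ) = (nearFam d k).card := by rw [haG, ← hk]
    have e1 : (memStates (d + 2) (n + 2 + 2) : ℝ) = (nearFam d (k + 1)).card := by
      rw [haG, show (n + 2 + 2) / 2 = k + 1 by omega]
    have e2 : (memStates (d + 2) (n + 4 + 2) : ℝ) = (nearFam d (k + 2)).card := by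
      rw [haG, show (n + 4 + 2) / 2 = k + 2 by omega]
    have hkey := hK k hkK
    rw [e0, e1, e2]
    -- `D/k ≤ 2|D|/n` since `n ≤ 2k`
    have hDk : D / k ≤ 2 * |D| / n := by
      rw [div_le_div_iff₀ hk0 hn0]
      have h1 : D * n ≤ |D| * n := mul_le_mul_of_nonneg_right (le_abs_self D) hn0.le
      have h2 : |D| * (n : ℝ) ≤ |D| * (2 * k) :=
        mul_le_mul_of_nonneg_left (by exact_mod_cast (by omega : n ≤ 2 * k)) (abs_nonneg D)
      nlinarith
    linarith
  have h := tendsto_ratio_of_kesten (a := fun n : ℕ => (memStates (d + 2) (n + 2) : ℝ))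
    (connectiveConstant_pos (d + 2)) hapos (tendsto_memStates_rpow d) hii hiii
  refine h.congr' (Eventually.of_forall fun n => ?_)
  simp only [show n + 2 + 2 = n + 4 by omega]

/-- **C3 (i), the PRICE LAW, PROVED**: for every `d ≥ 2`, `memStates d (2m+2) / memStates d (2m) → μ(ℤ^d)²` — the cost of one
more memory rung of the lane's automata tends to the square of the connective constant, exactly (STRUCTURE.md C3 (i); typed
`@[conjecture] priceLaw` of `…PcintClassCountLaw.lean` discharged). [cite: MadrasSlade1993, Theorem 7.3.4 (Kesten 1963)] -/
theorem priceLaw_holds : priceLaw := by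
  intro d hd
  obtain ⟨d', rfl⟩ : ∃ d', d = d' + 2 := ⟨d - 2, by omega⟩
  have h := tendsto_memStates_ratio d'
  -- along `n = 2m`: `memStates (2m+4)/memStates (2m+2)`, i.e. the price law shifted by one
  have h2 : Tendsto (fun m : ℕ => (memStates (d' + 2) (2 * (m + 1) + 2) : ℝ) / memStates (d' + 2) (2 * (m + 1))) atTop
      (𝓝 (connectiveConstant (d' + 2) ^ 2)) := by
    have hcomp := h.comp (tendsto_atTop_mono (fun m : ℕ => (by omega : m ≤ 2 * m)) tendsto_id)
    refine hcomp.congr fun m => ?_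
    simp only [Function.comp_apply, show 2 * (m + 1) = 2 * m + 2 by ring]
  exact (tendsto_add_atTop_iff_nat (f := fun m : ℕ =>
    (memStates (d' + 2) (2 * m + 2) : ℝ) / memStates (d' + 2) (2 * m)) 1).1 h2

end Summit.CriticalPhenomena.PercolationContinuityZ3.Theorems.Pcint.MemoryTail
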